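import Summits.CriticalPhenomena.PercolationContinuityZ3.Theorems.Transplant.GrigorchukWeightedLength
import Summits.CriticalPhenomena.PercolationContinuityZ3.Theorems.Transplant.GrigorchukFiniteModel
import HarnessLib

/-!
# INVERTED ORBITS of the first Grigorchuk group on the orbit of `ρ = 1^∞` (Bartholdi–Erschler 2012, §2.2 and §4): the splitting
# `δ(w) ≤ δ(A w) + δ(B w)` through the two TRACK words, invariance under Klein pre-reduction, and the `13/16` contraction of the tracks

builds on p205010 (kernel theorem, internal audit signed; external expert review pending) — nothing in this file uses p205010; pure group theory / word
combinatorics of `𝔊` acting on rays, no percolation statement, no growth statement, no node touched.  Lane `prim-bschramm`, seat `prim-bschramm-gen-1` gen 9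
(GEN pen; offer O-BE file F-BE1, lead g26 GO 2026-08-28T09:30Z).  DEFINITION LANE (review-queued): the inverted orbit `io w` of a word and its size `dlt w`, the
letter counts `nA` / `nT`, the `a`-parity `apar`, the track words `track s w`, the Klein pre-reduction `pushT` / `prered` and the predicate `preRed`; everything
else is theorems.  Helper file (`--supports stmt-CriticalPhenomena-4575 --as helper`).  No instance, no notation; REUSES p590723 «GrigorchukNormalForms» (`Letter`,
`BCD`, `V4`, `V4.mul`, `V4.toPerm_mul`), p591617 «GrigorchukTorsion» (the section words `sw`), p590401 «GrigorchukSectionsDefs» (`cons`, `genX_cons_*`), G1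
«GrigorchukWeightedLength» p609360 (`wordLW`, `Letter.lw`, `lw_sw_add`, `V4.lw_mul_le`) and «GrigorchukFiniteModel» (`evalPerm`) — nothing restated.

THE OBJECT.  For a word `w = x₁ x₂ ⋯ xₙ` over `{a, b, c, d}` the lamplighter walk on `ℤ ≀_X 𝔊` driven by `w` can only light lamps at the rays
`(x₁ ∘ ⋯ ∘ x_j)(ρ)`, `0 ≤ j ≤ n` (the permutations of the tree compose on the LEFT, so `x_j` acts first): this set is the INVERTED ORBIT `io w` (Bartholdi–Erschler's
`𝒪` of the reversed word, their §2.2; `δ(w) = #𝒪(w)`).  Its growth, not the orbit's, controls the growth of the permutational wreath product.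
* §1 `io`, `dlt`: `ρ ∈ io w`; prefix evaluations lie in `io w` and exhaust it; `io (x v :: w) = (io w).image v` (Klein letters fix `ρ`), so **`dlt w ≤ nA w + 1`**.
* §2 `apar`, `track`: the KEY IDENTITY **`evalPerm w (cons (xor s (apar w)) y) = cons s (evalPerm (track s w) y)`** (the wreath recursion read along the `a`-parity;
  `track s (w.take j)` is a prefix of `track s w`), whence the SPLITTING **`io w ⊆ (io (track false w)).image (cons false) ∪ (io (track true w)).image (cons true)`**
  and **`dlt w ≤ dlt (track false w) + dlt (track true w)`** (B–E Prop. 4.4, `δ(w) ≤ δ(u) + δ(v)`); `(track s w).length ≤ nT w`.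
* §3 `pushT`, `prered`, `preRed`: merging ADJACENT Klein letters (never `a a` — that changes the inverted orbit) keeps `evalPerm` and `io` (B–E Lemma 4.1), does not
  increase `wordLW` or the length, and yields a pre-reduced word, in which `2·nT ≤ length + 1`.
* §4 the CONTRACTION (B–E Lemma 4.2 with G1's integer weights `3000/3400/2200/1225`, `η = 13/16`): for pre-reduced `w`,
  **`16·(wordLW (track s w) + wordLW (track (!s) w)) ≤ 13·(wordLW w + 3000)`** — the sequel F-BE2 iterates it.
[cite: BartholdiErschler2012, §2.2 (inverted orbits), Lemma 4.1, Lemma 4.2, Prop. 4.4] [cite: Bartholdi1998, Prop. (η-contraction of the weighted metric)]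
[cite: Grigorchuk1980, relations b = (a,c), c = (a,d), d = (1,b)]
-/

noncomputable section

namespace Summit.CriticalPhenomena.PercolationContinuityZ3.Theorems.Transplant
namespace Grigorchuk

open scoped Classical
/-! ## §1 The inverted orbit of a word and its size -/

/-- **The inverted orbit** of a word `w = x₁ ⋯ xₙ`: the rays `(x₁ ∘ ⋯ ∘ x_j)(ρ)`, `0 ≤ j ≤ n`, defined by the recursion `io [] = {ρ}`,
`io (x :: w) = {ρ} ∪ x·(io w)`. [cite: BartholdiErschler2012, §2.2 (inverted orbit 𝒪(w))] -/
def io : List Letter → Finset Ray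
  | [] => {rho}
  | x :: w => insert rho ((io w).image (Letter.toPerm x))
/-- **`δ(w) = #io(w)`**, the inverted orbit growth of the word. [cite: BartholdiErschler2012, §2.2 (δ(w) = #𝒪(w))] -/
def dlt (w : List Letter) : ℕ := (io w).card
/-- The number of letters `a` in a word. [folklore] -/
def nA : List Letter → ℕ
  | [] => 0
  | .a :: w => nA w + 1
  | .x _ :: w => nA w
/-- The number of Klein letters `b, c, d` in a word. [folklore] -/
def nT : List Letter → ℕ
  | [] => 0
  | .a :: w => nT w
  | .x _ :: w => nT w + 1
/-- `io [] = {ρ}`. [folklore] -/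
@[simp] theorem io_nil : io [] = {rho} := rfl
/-- `io (x :: w) = {ρ} ∪ x·io(w)`. [folklore] -/
@[simp] theorem io_cons (x : Letter) (w : List Letter) : io (x :: w) = insert rho ((io w).image (Letter.toPerm x)) := rfl

/-- `ρ ∈ io w` (the empty prefix). [cite: BartholdiErschler2012, §2.2] -/
theorem rho_mem_io (w : List Letter) : rho ∈ io w := by
  cases w with
  | nil => exact Finset.mem_singleton_self _
  | cons x w => exact Finset.mem_insert_self _ _
/-- `δ(w) ≥ 1`. [folklore] -/
theorem one_le_dlt (w : List Letter) : 1 ≤ dlt w := Finset.card_pos.2 ⟨rho, rho_mem_io w⟩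

/-- **Every prefix evaluation `(x₁ ∘ ⋯ ∘ x_j)(ρ)` lies in `io w`.** [cite: BartholdiErschler2012, §2.2] -/
theorem evalPerm_take_mem_io : ∀ (w : List Letter) (j : ℕ), evalPerm (w.take j) rho ∈ io w
  | [], j => by simp
  | x :: w, 0 => by simp
  | x :: w, j + 1 => by
    rw [List.take_succ_cons, evalPerm_cons, io_cons, Equiv.Perm.mul_apply]
    exact Finset.mem_insert_of_mem (Finset.mem_image_of_mem _ (evalPerm_take_mem_io w j))

/-- **Conversely every point of `io w` is a prefix evaluation.** [cite: BartholdiErschler2012, §2.2] -/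
theorem exists_take_of_mem_io : ∀ (w : List Letter) {x : Ray}, x ∈ io w → ∃ j, x = evalPerm (w.take j) rho
  | [], x, hx => ⟨0, by simpa using hx⟩
  | y :: w, x, hx => by
    rw [io_cons, Finset.mem_insert, Finset.mem_image] at hx
    rcases hx with rfl | ⟨z, hz, rfl⟩
    · exact ⟨0, by simp⟩
    · obtain ⟨j, rfl⟩ := exists_take_of_mem_io w hz
      exact ⟨j + 1, by rw [List.take_succ_cons, evalPerm_cons, Equiv.Perm.mul_apply]⟩
/-- A Klein letter fixes `ρ`. [cite: BartholdiErschler2012, §4 ("this ray is fixed by b, c, d")] -/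
theorem bcd_rho (v : BCD) : v.toPerm rho = rho := by
  cases v
  · exact genB_rho
  · exact genC_rho
  · exact genD_rho

/-- **`io (v :: w) = v·io(w)` for a Klein letter** (`ρ = v ρ` is already in the image). [cite: BartholdiErschler2012, Lemma 4.1] -/
theorem io_cons_x (v : BCD) (w : List Letter) : io (.x v :: w) = (io w).image (BCD.toPerm v) := by
  rw [io_cons]
  refine Finset.insert_eq_of_mem ?_
  exact Finset.mem_image.2 ⟨rho, rho_mem_io w, bcd_rho v⟩
/-- `δ(v :: w) ≤ δ(w)` for a Klein letter. [cite: BartholdiErschler2012, Lemma 4.1] -/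
theorem dlt_cons_x_le (v : BCD) (w : List Letter) : dlt (.x v :: w) ≤ dlt w := by
  unfold dlt; rw [io_cons_x]; exact Finset.card_image_le
/-- `δ(a :: w) ≤ δ(w) + 1`. [folklore] -/
theorem dlt_cons_a_le (w : List Letter) : dlt (.a :: w) ≤ dlt w + 1 := by
  unfold dlt; rw [io_cons]
  exact (Finset.card_insert_le _ _).trans (Nat.add_le_add_right Finset.card_image_le 1)

/-- **The trivial bound `δ(w) ≤ #a(w) + 1`**: only the prefixes ending before an `a` (and the whole word) contribute. [cite: BartholdiErschler2012, §2.2 (Δ(n) ≤ n + 1)] -/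
theorem dlt_le_nA_succ : ∀ w : List Letter, dlt w ≤ nA w + 1
  | [] => by simp [dlt, nA]
  | .a :: w => (dlt_cons_a_le w).trans (by rw [nA]; exact Nat.add_le_add_right (dlt_le_nA_succ w) 1)
  | .x v :: w => (dlt_cons_x_le v w).trans (by rw [nA]; exact dlt_le_nA_succ w)
/-- `3000·#a(w) ≤ wordLW w`. [cite: Bartholdi1998, Prop. (the weighted metric)] -/
theorem nA_le_wordLW : ∀ w : List Letter, 3000 * nA w ≤ wordLW w
  | [] => by simp [nA]
  | .a :: w => by
    rw [nA, show Letter.a :: w = [Letter.a] ++ w from rfl, wordLW_append]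
    have : wordLW [Letter.a] = 3000 := by decide
    have := nA_le_wordLW w; omega
  | .x v :: w => by
    rw [nA, show Letter.x v :: w = [Letter.x v] ++ w from rfl, wordLW_append]
    have := nA_le_wordLW w; omega

/-! ## §2 The `a`-parity, the track words, the key identity and the splitting -/

/-- The parity of the number of `a`'s in a word (`true` = odd). [cite: BartholdiErschler2012, §4 (w = ε^s⟨u, v⟩: s)] -/
def apar : List Letter → Bool
  | [] => false
  | .a :: w => !apar w
  | .x _ :: w => apar w

/-- **The track word** `track s w`: read `w` from the left, flip the state at each `a`, and at each Klein letter `v` emit its section word `sw state v`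
(p591617).  `track false w` / `track true w` are Bartholdi–Erschler's `u` / `v` of `w = ε^s⟨u, v⟩` for the reversed word. [cite: BartholdiErschler2012, §4 (the map Ω → 𝔖₂ × Ω × Ω)] -/
def track : Bool → List Letter → List Letter
  | _, [] => []
  | s, .a :: w => track (!s) w
  | s, .x v :: w => sw s v ++ track s w
/-- `track s [] = []`. [folklore] -/
@[simp] theorem track_nil (s : Bool) : track s [] = [] := by cases s <;> rfl
/-- `track s (a :: w) = track ¬s w`. [folklore] -/
@[simp] theorem track_cons_a (s : Bool) (w : List Letter) : track s (.a :: w) = track (!s) w := by cases s <;> rfl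
/-- `track s (v :: w) = sw s v ++ track s w`. [folklore] -/
@[simp] theorem track_cons_x (s : Bool) (v : BCD) (w : List Letter) : track s (.x v :: w) = sw s v ++ track s w := by cases s <;> rfl

/-- **A Klein letter on a prepended ray acts by its section word**: `v (s·z) = s·((v)_s z)`. [cite: Grigorchuk1980, relations b = (a,c), c = (a,d), d = (1,b)] -/
theorem bcd_apply_cons (s : Bool) (v : BCD) (z : Ray) : v.toPerm (cons s z) = cons s (evalPerm (sw s v) z) := by
  cases s <;> cases v
  · simpa [sw, evalPerm_cons, Letter.toPerm, BCD.toPerm, BCD.toV4, V4.toPerm] using genB_cons_false z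
  · simpa [sw, evalPerm_cons, Letter.toPerm, BCD.toPerm, BCD.toV4, V4.toPerm] using genC_cons_false z
  · simpa [sw, BCD.toPerm, BCD.toV4, V4.toPerm] using genD_cons_false z
  · simpa [sw, evalPerm_cons, Letter.toPerm, BCD.toPerm, BCD.toV4, V4.toPerm] using genB_cons_true z
  · simpa [sw, evalPerm_cons, Letter.toPerm, BCD.toPerm, BCD.toV4, V4.toPerm] using genC_cons_true z
  · simpa [sw, evalPerm_cons, Letter.toPerm, BCD.toPerm, BCD.toV4, V4.toPerm] using genD_cons_true z

/-- **THE KEY IDENTITY (wreath recursion along the `a`-parity)**: `w (s⊕apar(w) · y) = s · (track s w) y`. [cite: BartholdiErschler2012, §4 (w = ε^s⟨u, v⟩)] -/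
theorem evalPerm_apply_cons : ∀ (w : List Letter) (s : Bool) (y : Ray), evalPerm w (cons (xor s (apar w)) y) = cons s (evalPerm (track s w) y)
  | [], s, y => by simp [apar]
  | .a :: w, s, y => by
    have e : xor s (apar (.a :: w)) = xor (!s) (apar w) := by rw [apar]; cases s <;> cases apar w <;> rfl
    rw [e, evalPerm_cons, Equiv.Perm.mul_apply, evalPerm_apply_cons w (!s) y, track_cons_a]
    show genA (cons (!s) _) = _
    rw [genA_cons, Bool.not_not]
  | .x v :: w, s, y => by
    rw [show apar (.x v :: w) = apar w from rfl, evalPerm_cons, Equiv.Perm.mul_apply, evalPerm_apply_cons w s y, track_cons_x,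
      show evalPerm (sw s v ++ track s w) = evalPerm (sw s v) * evalPerm (track s w) from prod_append_letters _ _, Equiv.Perm.mul_apply]
    exact bcd_apply_cons s v _
/-- `ρ = 1·ρ`. [folklore] -/
theorem rho_eq_cons : rho = cons true rho := by
  funext n; cases n <;> rfl

/-- **`w(ρ) = s·(track s w)(ρ)` with `s = ¬apar(w)`** (even `a`-parity: first letter `1` and the track `v`; odd: first letter `0` and the track `u`). [cite: BartholdiErschler2012, proof of Prop. 4.4 (ρw′ = 1ρv′ if s′ = 0, 0ρu′ if s′ = 1)] -/
theorem evalPerm_rho (w : List Letter) : evalPerm w rho = cons (!apar w) (evalPerm (track (!apar w) w) rho) := by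
  have e : xor (!apar w) (apar w) = true := by cases apar w <;> rfl
  conv_lhs => rw [rho_eq_cons, ← e]
  exact evalPerm_apply_cons w _ rho

/-- **Tracks of prefixes are prefixes of tracks.** [cite: BartholdiErschler2012, proof of Prop. 4.4 (u′, v′ are suffixes of u, v)] -/
theorem track_take_prefix : ∀ (w : List Letter) (s : Bool) (j : ℕ), track s (w.take j) <+: track s w
  | [], s, j => by simp
  | x :: w, s, 0 => by simp
  | .a :: w, s, j + 1 => by
    rw [List.take_succ_cons, track_cons_a, track_cons_a]
    exact track_take_prefix w (!s) j
  | .x v :: w, s, j + 1 => by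
    rw [List.take_succ_cons, track_cons_x, track_cons_x]
    exact (List.prefix_append_right_inj (sw s v)).2 (track_take_prefix w s j)

/-- **THE SPLITTING `io w ⊆ 0·io(track 0 w) ∪ 1·io(track 1 w)`.** [cite: BartholdiErschler2012, proof of Prop. 4.4] -/
theorem io_subset_tracks (w : List Letter) :
    io w ⊆ (io (track false w)).image (cons false) ∪ (io (track true w)).image (cons true) := by
  intro x hx
  obtain ⟨j, rfl⟩ := exists_take_of_mem_io w hx
  rw [evalPerm_rho]
  set s := !apar (w.take j) with hs
  obtain ⟨t, ht⟩ := track_take_prefix w s j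
  have hmem : evalPerm (track s (w.take j)) rho ∈ io (track s w) := by
    have e : track s (w.take j) = (track s w).take (track s (w.take j)).length := List.prefix_iff_eq_take.1 ⟨t, ht⟩
    rw [e]; exact evalPerm_take_mem_io _ _
  rw [Finset.mem_union]
  cases hb : s with
  | false => rw [hb] at hmem; exact Or.inl (Finset.mem_image_of_mem _ hmem)
  | true => rw [hb] at hmem; exact Or.inr (Finset.mem_image_of_mem _ hmem)

/-- **`δ(w) ≤ δ(track 0 w) + δ(track 1 w)`** (Bartholdi–Erschler's `δ(w) ≤ δ(u) + δ(v)`). [cite: BartholdiErschler2012, Prop. 4.4] -/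
theorem dlt_le_tracks (w : List Letter) : dlt w ≤ dlt (track false w) + dlt (track true w) := by
  unfold dlt
  exact (Finset.card_le_card (io_subset_tracks w)).trans
    ((Finset.card_union_le _ _).trans (Nat.add_le_add Finset.card_image_le Finset.card_image_le))
/-- A section word has at most one letter. [cite: Grigorchuk1980, relations b = (a,c), c = (a,d), d = (1,b)] -/
theorem length_sw_le_one (s : Bool) (v : BCD) : (sw s v).length ≤ 1 := by
  cases s <;> cases v <;> decide
/-- `|track s w| ≤ #bcd(w)`. [cite: BartholdiErschler2012, Lemma 4.2 (letters of u, v come from the b, c, d of w)] -/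
theorem length_track_le : ∀ (w : List Letter) (s : Bool), (track s w).length ≤ nT w
  | [], s => by simp [nT]
  | .a :: w, s => by rw [track_cons_a, nT]; exact length_track_le w (!s)
  | .x v :: w, s => by
    rw [track_cons_x, nT, List.length_append]
    have := length_sw_le_one s v; have := length_track_le w s; omega

/-! ## §3 Klein pre-reduction: merge adjacent `b, c, d` (never `a a`) -/

/-- Push a Klein letter onto a word, merging it with a leading Klein letter (`x x′ ↦` their product in `{1, b, c, d}`). [cite: BartholdiErschler2012, §4 (pre-reduction)] -/
def pushT (v : BCD) : List Letter → List Letter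
  | .x v' :: w =>
    match V4.mul v.toV4 v'.toV4 with
    | .e => w
    | .b => .x .b :: w
    | .c => .x .c :: w
    | .d => .x .d :: w
  | w => .x v :: w

/-- **The pre-reduction of a word**: delete / merge consecutive Klein letters, keep every `a`. [cite: BartholdiErschler2012, §4 (pre-reduction)] -/
def prered : List Letter → List Letter
  | [] => []
  | .a :: w => .a :: prered w
  | .x v :: w => pushT v (prered w)
/-- `pushT v [] = [v]`. [folklore] -/
@[simp] theorem pushT_nil (v : BCD) : pushT v [] = [.x v] := rfl
/-- `pushT v (a :: w) = v :: a :: w`. [folklore] -/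
@[simp] theorem pushT_cons_a (v : BCD) (w : List Letter) : pushT v (.a :: w) = .x v :: .a :: w := rfl

/-- The product of two Klein letters as a word of at most one letter. [cite: Grigorchuk1980, {1, b, c, d} ≅ (ℤ/2)²] -/
def kleinWord : V4 → List Letter
  | .e => []
  | .b => [.x .b]
  | .c => [.x .c]
  | .d => [.x .d]
/-- `pushT v (v′ :: w) = (v v′) ++ w`. [folklore] -/
theorem pushT_cons_x (v v' : BCD) (w : List Letter) : pushT v (.x v' :: w) = kleinWord (V4.mul v.toV4 v'.toV4) ++ w := by
  rw [pushT]
  cases V4.mul v.toV4 v'.toV4 <;> rfl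
/-- The word of a Klein product evaluates to it. [cite: Grigorchuk1980, {1, b, c, d} ≅ (ℤ/2)²] -/
theorem evalPerm_kleinWord (q : V4) : evalPerm (kleinWord q) = q.toPerm := by
  cases q <;> simp [kleinWord, evalPerm_cons, Letter.toPerm, BCD.toPerm, BCD.toV4, V4.toPerm]
/-- The word of a Klein product weighs at most the product's weight. [cite: Bartholdi1998, Prop. (the weighted metric)] -/
theorem wordLW_kleinWord (q : V4) : wordLW (kleinWord q) = q.lw := by
  cases q <;> decide
/-- The word of a Klein product has at most one letter. [folklore] -/
theorem length_kleinWord_le (q : V4) : (kleinWord q).length ≤ 1 := by cases q <;> decide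

/-- **`pushT` does not change the group element**: `eval (pushT v w) = v · eval w`. [cite: Grigorchuk1980, the Klein relations] -/
theorem evalPerm_pushT (v : BCD) : ∀ w : List Letter, evalPerm (pushT v w) = v.toPerm * evalPerm w
  | [] => by simp [evalPerm_cons, Letter.toPerm]
  | .a :: w => by rw [pushT_cons_a, evalPerm_cons]; rfl
  | .x v' :: w => by
    rw [pushT_cons_x, show evalPerm (kleinWord (V4.mul v.toV4 v'.toV4) ++ w) = evalPerm (kleinWord (V4.mul v.toV4 v'.toV4)) * evalPerm w from
      prod_append_letters _ _, evalPerm_kleinWord, V4.toPerm_mul, evalPerm_cons, mul_assoc]; rfl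

/-- **Pre-reduction does not change the group element.** [cite: BartholdiErschler2012, §4 ("these operations do not change the image of the word in 𝔊")] -/
theorem evalPerm_prered : ∀ w : List Letter, evalPerm (prered w) = evalPerm w
  | [] => rfl
  | .a :: w => by rw [prered, evalPerm_cons, evalPerm_cons, evalPerm_prered w]
  | .x v :: w => by rw [prered, evalPerm_pushT, evalPerm_prered w, evalPerm_cons]; rfl

/-- `io (pushT v w) = v·io(w)` (`= io (v :: w)`). [cite: BartholdiErschler2012, Lemma 4.1] -/
theorem io_pushT (v : BCD) : ∀ w : List Letter, io (pushT v w) = (io w).image (BCD.toPerm v)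
  | [] => by rw [pushT_nil, io_cons_x]
  | .a :: w => by rw [pushT_cons_a, io_cons_x]
  | .x v' :: w => by
    rw [pushT_cons_x, io_cons_x, Finset.image_image]
    have hcomp : (BCD.toPerm v : Ray → Ray) ∘ (BCD.toPerm v' : Ray → Ray) = ((V4.mul v.toV4 v'.toV4).toPerm : Ray → Ray) := by
      funext z; rw [V4.toPerm_mul]; rfl
    rw [hcomp]
    cases V4.mul v.toV4 v'.toV4 with
    | e =>
      rw [kleinWord, List.nil_append]
      exact (Finset.image_id (s := io w)).symm.trans (by rfl)
    | b => exact io_cons_x .b w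
    | c => exact io_cons_x .c w
    | d => exact io_cons_x .d w

/-- **Pre-reduction does not change the inverted orbit** (B–E Lemma 4.1: `δ(w) = δ(pre-reduction)`). [cite: BartholdiErschler2012, Lemma 4.1] -/
theorem io_prered : ∀ w : List Letter, io (prered w) = io w
  | [] => rfl
  | .a :: w => by rw [prered, io_cons, io_cons, io_prered w]
  | .x v :: w => by rw [prered, io_pushT, io_prered w, io_cons_x]
/-- `δ(prered w) = δ(w)`. [cite: BartholdiErschler2012, Lemma 4.1] -/
theorem dlt_prered (w : List Letter) : dlt (prered w) = dlt w := by
  unfold dlt; rw [io_prered]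

/-- `wordLW (pushT v w) ≤ lw v + wordLW w` (Klein triangle inequalities of G1). [cite: Bartholdi1998, Prop. (the weighted metric)] -/
theorem wordLW_pushT_le (v : BCD) : ∀ w : List Letter, wordLW (pushT v w) ≤ (Letter.x v).lw + wordLW w
  | [] => by rw [pushT_nil]; rfl
  | .a :: w => by rw [pushT_cons_a]; rfl
  | .x v' :: w => by
    rw [pushT_cons_x, wordLW_append, wordLW_kleinWord, show Letter.x v' :: w = [Letter.x v'] ++ w from rfl, wordLW_append,
      show wordLW [Letter.x v'] = v'.toV4.lw by cases v' <;> rfl, ← BCD.lw_toV4, ← add_assoc]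
    exact Nat.add_le_add_right (V4.lw_mul_le _ _) _

/-- **Pre-reduction does not increase the weighted length.** [cite: BartholdiErschler2012, §4 (the norm of the pre-reduction)] -/
theorem wordLW_prered_le : ∀ w : List Letter, wordLW (prered w) ≤ wordLW w
  | [] => le_rfl
  | .a :: w => by
    rw [prered, show Letter.a :: prered w = [Letter.a] ++ prered w from rfl, show Letter.a :: w = [Letter.a] ++ w from rfl, wordLW_append, wordLW_append]
    exact Nat.add_le_add_left (wordLW_prered_le w) _
  | .x v :: w => by
    rw [prered, show Letter.x v :: w = [Letter.x v] ++ w from rfl, wordLW_append]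
    exact (wordLW_pushT_le v _).trans (Nat.add_le_add_left (wordLW_prered_le w) _)
/-- `|pushT v w| ≤ |w| + 1`. [folklore] -/
theorem length_pushT_le (v : BCD) : ∀ w : List Letter, (pushT v w).length ≤ w.length + 1
  | [] => by simp
  | .a :: w => by simp
  | .x v' :: w => by
    rw [pushT_cons_x, List.length_append, List.length_cons]
    have := length_kleinWord_le (V4.mul v.toV4 v'.toV4); omega

/-- **Pre-reduction does not increase the length.** [cite: BartholdiErschler2012, §4] -/
theorem length_prered_le : ∀ w : List Letter, (prered w).length ≤ w.length
  | [] => le_rfl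
  | .a :: w => by rw [prered, List.length_cons, List.length_cons]; exact Nat.succ_le_succ (length_prered_le w)
  | .x v :: w => by rw [prered, List.length_cons]; exact (length_pushT_le v _).trans (Nat.succ_le_succ (length_prered_le w))

/-- **Pre-reduced words**: no two adjacent Klein letters. [cite: BartholdiErschler2012, §4 ("pre-reduced")] -/
def preRed : List Letter → Bool
  | [] => true
  | .a :: w => preRed w
  | .x _ :: [] => true
  | .x _ :: .a :: w => preRed w
  | .x _ :: .x _ :: _ => false

/-- A pre-reduced word with a Klein letter pushed is pre-reduced. [cite: BartholdiErschler2012, §4] -/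
theorem preRed_pushT (v : BCD) : ∀ w : List Letter, preRed w = true → preRed (pushT v w) = true
  | [], _ => rfl
  | .a :: w, h => by rw [pushT_cons_a]; exact h
  | .x v' :: [], _ => by rw [pushT_cons_x]; cases V4.mul v.toV4 v'.toV4 <;> rfl
  | .x v' :: .a :: w, h => by
    rw [pushT_cons_x]
    have h' : preRed w = true := h
    cases V4.mul v.toV4 v'.toV4 <;> exact h'
  | .x _ :: .x _ :: _, h => by exact absurd h (by simp [preRed])

/-- **The pre-reduction is pre-reduced.** [cite: BartholdiErschler2012, §4] -/
theorem preRed_prered : ∀ w : List Letter, preRed (prered w) = true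
  | [] => rfl
  | .a :: w => by rw [prered]; exact preRed_prered w
  | .x v :: w => by rw [prered]; exact preRed_pushT v _ (preRed_prered w)

/-- **In a pre-reduced word at most every other letter is a Klein letter**: `2·#bcd ≤ length + 1`. [cite: BartholdiErschler2012, §4 ("at most (n+1)/2 letters in {b,c,d}")] -/
theorem two_nT_le : ∀ w : List Letter, preRed w = true → 2 * nT w ≤ w.length + 1
  | [], _ => by simp [nT]
  | .a :: w, h => by
    have := two_nT_le w h
    rw [nT, List.length_cons]; omega
  | .x _ :: [], _ => by simp [nT]
  | .x _ :: .a :: w, h => by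
    have := two_nT_le w h
    simp only [nT, List.length_cons]; omega
  | .x _ :: .x _ :: _, h => absurd h (by simp [preRed])

/-! ## §4 The `13/16` contraction of the tracks of a pre-reduced word -/

/-- **CONTRACTION (B–E Lemma 4.2 with G1's weights)**: for a pre-reduced word, `16·(‖track s w‖ + ‖track ¬s w‖) ≤ 13·(‖w‖ + ‖a‖)` — each Klein letter but possibly
the last is followed by an `a`, and G1's `lw_sw_add` bounds its two sections by `13/16` of the pair. [cite: BartholdiErschler2012, Lemma 4.2] [cite: Bartholdi1998, Prop. (η-contraction)] -/
theorem lw_tracks_le : ∀ (w : List Letter) (s : Bool), preRed w = true → 16 * (wordLW (track s w) + wordLW (track (!s) w)) ≤ 13 * (wordLW w + 3000)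
  | [], s, _ => by simp
  | .a :: w, s, h => by
    rw [track_cons_a, track_cons_a, Bool.not_not, show Letter.a :: w = [Letter.a] ++ w from rfl, wordLW_append]
    have ha : wordLW [Letter.a] = 3000 := rfl
    have h1 := lw_tracks_le w s h
    rw [ha]
    omega
  | .x v :: [], s, _ => by
    rw [track_cons_x, track_cons_x, track_nil, track_nil, List.append_nil, List.append_nil,
      show wordLW [Letter.x v] = v.toV4.lw by cases v <;> rfl]
    exact lw_sw_add s v
  | .x v :: .a :: w, s, h => by
    have h' : preRed w = true := h
    rw [track_cons_x, track_cons_x, track_cons_a, track_cons_a, Bool.not_not, wordLW_append, wordLW_append,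
      show Letter.x v :: Letter.a :: w = [Letter.x v] ++ [Letter.a] ++ w from rfl, wordLW_append, wordLW_append,
      show wordLW [Letter.x v] = v.toV4.lw by cases v <;> rfl, show wordLW [Letter.a] = 3000 from rfl]
    have h1 := lw_sw_add s v
    have h2 := lw_tracks_le w (!s) h'
    rw [Bool.not_not] at h2
    omega
  | .x _ :: .x _ :: _, s, h => absurd h (by simp [preRed])

end Grigorchuk
end Summit.CriticalPhenomena.PercolationContinuityZ3.Theorems.Transplant
end
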